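import Mathlib
import Summits.KontsevichZagierPeriods.KontsevichZagierPeriods.Theorems.SoloInformedKappaPath
import Summits.KontsevichZagierPeriods.KontsevichZagierPeriods.Theorems.SoloInformedKappaOmega
import HarnessLib

/-!
# SoloInformed — `κ(ω, γ)` depends only on `γ|[0,1]`; `κ` of a constant map vanishes (toolkit for (HT))

File I1⁺ of the (HT) step.  Two Nash maps `γ₁, γ₂ : ℝ → ℂⁿ` that agree on `[0,1]` have the
same form integrand `Σᵢ ωᵢ(γ) γᵢ′` on `[0,1]` — including the endpoints, where the (two-sided)
derivatives agree because `[0,1]` is a set of unique differentiability — hence the same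
`κ(ω, γ) ∈ V` (`soloInformed_kappaPath_congr`).  A constant map has `κ = 0`
(`soloInformed_kappaPath_const`).
In the (HT) grid the edge paths handed to the Coons cells (pieces of the given paths, chords,
constants) are compared with each other only through their values on `[0,1]`.
-/

noncomputable section

open scoped BigOperators
open MeasureTheory Set MvPolynomial
open Literature.NumberTheory.Transcendental Literature.NumberTheory.Transcendental.KZ
open Literature.NumberTheory.Transcendental.CurvePeriods
open Literature.ModelTheory.ExponentialFields

namespace Summit.KontsevichZagierPeriods.KontsevichZagierPeriods.Theorems

variable {n : ℕ}

/-- A Nash map is differentiable (coordinatewise) at every point of `[0,1]`. -/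
theorem SoloInformedIsNashPath.differentiableAt_apply {γ : ℝ → Fin n → ℂ}
    (h : SoloInformedIsNashPath γ) {t : ℝ} (ht : t ∈ Icc (0 : ℝ) 1) (i : Fin n) :
    DifferentiableAt ℝ (fun u => γ u i) t := by
  obtain ⟨ε, hε, hd, _⟩ := h
  have hε' : (0 : ℝ) < ε := by exact_mod_cast hε
  have htI : t ∈ Ioo (-(ε : ℝ)) (1 + ε) := ⟨by linarith [ht.1], by linarith [ht.2]⟩
  have hγ : DifferentiableAt ℝ γ t :=
    (hd.differentiableOn one_ne_zero).differentiableAt (isOpen_Ioo.mem_nhds htI)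
  exact differentiableAt_pi.1 hγ i

/-- Two maps agreeing on `[0,1]` and differentiable there (coordinate `i`) have the same derivative
of coordinate `i` at every point of `[0,1]`, endpoints included. -/
theorem soloInformed_deriv_congr_Icc {γ₁ γ₂ : ℝ → Fin n → ℂ} (heq : EqOn γ₁ γ₂ (Icc 0 1))
    (i : Fin n) {t : ℝ} (ht : t ∈ Icc (0 : ℝ) 1) (h₁ : DifferentiableAt ℝ (fun u => γ₁ u i) t)
    (h₂ : DifferentiableAt ℝ (fun u => γ₂ u i) t) :
    deriv (fun u => γ₁ u i) t = deriv (fun u => γ₂ u i) t := by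
  have hu : UniqueDiffWithinAt ℝ (Icc (0 : ℝ) 1) t := uniqueDiffOn_Icc zero_lt_one t ht
  rw [← h₁.hasDerivAt.hasDerivWithinAt.derivWithin hu,
    ← h₂.hasDerivAt.hasDerivWithinAt.derivWithin hu]
  exact derivWithin_congr (fun u hu' => by simp only [heq hu']) (by simp only [heq ht])

/-- The form integrands of two Nash maps agreeing on `[0,1]` agree on `[0,1]`. -/
theorem soloInformedFormIntegrand_congr (ω : Fin n → MvPolynomial (Fin n) ℂ)
    {γ₁ γ₂ : ℝ → Fin n → ℂ} (h₁ : SoloInformedIsNashPath γ₁) (h₂ : SoloInformedIsNashPath γ₂)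
    (heq : EqOn γ₁ γ₂ (Icc 0 1)) {t : ℝ} (ht : t ∈ Icc (0 : ℝ) 1) :
    soloInformedFormIntegrand ω γ₁ t = soloInformedFormIntegrand ω γ₂ t := by
  unfold soloInformedFormIntegrand
  refine Finset.sum_congr rfl fun i _ => ?_
  rw [heq ht, soloInformed_deriv_congr_Icc heq i ht (h₁.differentiableAt_apply ht i)
    (h₂.differentiableAt_apply ht i)]

/-- **`κ(ω, γ)` depends only on `γ|[0,1]`.** -/
theorem soloInformed_kappaPath_congr (ω : Fin n → MvPolynomial (Fin n) ℂ)
    (hω : ∀ i, HasAlgCoeffs (ω i)) {γ₁ γ₂ : ℝ → Fin n → ℂ} (h₁ : SoloInformedIsNashPath γ₁)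
    (h₂ : SoloInformedIsNashPath γ₂) (heq : EqOn γ₁ γ₂ (Icc 0 1)) :
    soloInformedKappaPath ω hω γ₁ h₁ = soloInformedKappaPath ω hω γ₂ h₂ := by
  have hI : ∀ x ∈ soloInformedUnitI,
      soloInformedFormIntegrand ω γ₁ (x 0) = soloInformedFormIntegrand ω γ₂ (x 0) :=
    fun x hx => soloInformedFormIntegrand_congr ω h₁ h₂ heq hx
  unfold soloInformedKappaPath
  congr 1
  · exact soloInformed_toFormalPeriod_congr_of_eqOn rfl fun x hx => by
      simp only [soloInformedFormRepRe_integrand, hI x hx]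
  · exact soloInformed_toFormalPeriod_congr_of_eqOn rfl fun x hx => by
      simp only [soloInformedFormRepIm_integrand, hI x hx]

/-- A constant map at an algebraic point is a Nash map (bare-data form). -/
theorem soloInformed_isNashPath_constFun (p : Fin n → ℂ) (hp : ∀ i, IsAlgebraic ℚ (p i)) :
    SoloInformedIsNashPath (fun _ : ℝ => p) := by
  suffices H : ∀ ε : ℚ, 0 < ε → SoloInformedIsNashPath (fun _ : ℝ => p) from H 1 one_pos
  intro ε hε
  have hs := isSemialgebraic_soloInformedIoo1 (-ε) (1 + ε)
  push_cast at hs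
  exact ⟨ε, hε, contDiffOn_const, fun i => SoloInformedReImSA.const hs (hp i)⟩

/-- The form integrand of a constant map vanishes. -/
theorem soloInformedFormIntegrand_const (ω : Fin n → MvPolynomial (Fin n) ℂ) (p : Fin n → ℂ)
    (t : ℝ) : soloInformedFormIntegrand ω (fun _ : ℝ => p) t = 0 := by
  unfold soloInformedFormIntegrand
  simp only [deriv_const', mul_zero, Finset.sum_const_zero]

/-- **`κ` of a constant map is `0`.** -/
theorem soloInformed_kappaPath_const (ω : Fin n → MvPolynomial (Fin n) ℂ)
    (hω : ∀ i, HasAlgCoeffs (ω i)) (p : Fin n → ℂ) (h : SoloInformedIsNashPath (fun _ : ℝ => p)) :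
    soloInformedKappaPath ω hω (fun _ : ℝ => p) h = 0 := by
  ext
  · rw [soloInformedKappaPath_fst, SoloInformedV.fst_zero]
    exact toFormalPeriod_eq_zero_of_mem (of_mem_relations_of_eqOn_zero _ fun x _ => by
      simp only [soloInformedFormRepRe_integrand, soloInformedFormIntegrand_const, Complex.zero_re,
        Pi.zero_apply])
  · rw [soloInformedKappaPath_snd, SoloInformedV.snd_zero]
    exact toFormalPeriod_eq_zero_of_mem (of_mem_relations_of_eqOn_zero _ fun x _ => by
      simp only [soloInformedFormRepIm_integrand, soloInformedFormIntegrand_const, Complex.zero_im,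
        Pi.zero_apply])

end Summit.KontsevichZagierPeriods.KontsevichZagierPeriods.Theorems
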